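import Literature.Algebra.Homology.CharpolyHomologyShortComplex
import Literature.Algebra.Homology.CharpolyEulerPoincare
import Mathlib.LinearAlgebra.Determinant
import HarnessLib

/-!
# Determinants of an automorphism of a complex and of its homology: `∏ᶠ det(φᵢ)^{χ(i)} = ∏ᶠ det(H(φ)ᵢ)^{χ(i)}`

Layer `Literature/Algebra/Homology` (pure linear algebra over Mathlib; proved theorems only, 0 definitions, 0 named facts, no instances,
no notation). The DETERMINANT member of the family dimension ∕ trace ∕ characteristic polynomial (rows `EulerPoincareFormula`,
`HopfTraceFormula`, `CharpolyEulerPoincare`): `det` is multiplicative along an invariant subspace and its quotient (Mathlib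
`LinearMap.det_eq_det_mul_det`), hence an Euler–Poincaré map on AUTOMORPHISMS (Lang XX §3), and row `EulerPoincarePrinciple` applies to an
endomorphism `φ` (finite-dimensional terms, finitely many non-zero, every `det φᵢ ≠ 0`) of a homological complex of any shape:

* `det_τ₂_eq` — `det ψ.τ₂ = det H(ψ) · det(ψ.τ₃ | range g) · det(ψ.τ₂ | range f)` for an endomorphism `ψ` of a short complex of vector spaces
  (`X₂` finite-dimensional): Mathlib's factorisation TWICE, read through row `CharpolyHomologyShortComplex`'s conjugacy lemmas and
  `LinearMap.det_conj` (BY NAME);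
* `det_f_eq` — degreewise: `det φᵢ = det H(φ)ᵢ · det(φ_{next i} | im d(i, next i)) · det(φᵢ | im d(prev i, i))`;
* `det_restrict_ne_zero` — an endomorphism with non-zero determinant restricts to one on an invariant subspace;
* **`finprod_det_zpow_χ_eq : ∏ᶠ i, det(φᵢ)^{χ(i)} = ∏ᶠ i, det(H(φ)ᵢ)^{χ(i)}`** in `K` (`ℤ`-powers; hypothesis `∀ i, det φᵢ ≠ 0`).

Rows `CharpolyHomologyShortComplex` / `CharpolyEulerPoincare` (the charpoly statements whose constant coefficients these are, up to sign) are
NOT restated or re-derived. Library only (cell `pub-hodge-ring2`, count-neutral); proves nothing about any crux, route or conjecture.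

## References

* S. Lang, *Algebra* (2002), Ch. XX §3, Thm. 3.1 (Euler–Poincaré maps). [Lang2002]
* N. Bourbaki, *Algèbre, Chapitre VIII* (2012), §20 n°6 (multiplicativity in exact sequences). [BourbakiAlgebreVIII2012]
-/

open CategoryTheory CategoryTheory.Limits

universe v u w

namespace Literature.Algebra.Homology.HopfTrace

variable {K : Type u} [Field K]

/-- `det` is invariant under conjugation by a linear equivalence (Mathlib's `LinearMap.det_conj`, phrased with `LinearEquiv.conj`).
[cite: Lang2002, Ch. XX §3] -/
theorem det_linearEquiv_conj {M N : Type*} [AddCommGroup M] [Module K M] [AddCommGroup N] [Module K N] (f : M →ₗ[K] M)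
    (e : M ≃ₗ[K] N) : LinearMap.det (e.conj f) = LinearMap.det f := by
  rw [LinearEquiv.conj_apply, LinearMap.comp_assoc, LinearMap.det_conj]

/-! ### One short complex -/

section ShortComplex

variable (S : ShortComplex (ModuleCat.{v} K)) (ψ : S ⟶ S)

/-- **`det ψ.τ₂ = det H(ψ) · det(ψ.τ₃ | range g) · det(ψ.τ₂ | range f)`** for an endomorphism of a short complex of vector spaces (`X₂`
finite-dimensional): Mathlib's `det u = det(u|_p) · det(u mod p)` on `ker g ⊆ X₂` and on `range(X₁ → ker g) ⊆ ker g`, read through row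
`CharpolyHomologyShortComplex`'s conjugacy lemmas. [cite: BourbakiAlgebreVIII2012, VIII §20 n°6 (p. 377)] [cite: Lang2002, Ch. XX §3] -/
theorem det_τ₂_eq [Module.Finite K S.X₂] :
    LinearMap.det ψ.τ₂.hom =
      LinearMap.det (ShortComplex.homologyMap ψ).hom * LinearMap.det (ψ.τ₃.hom.restrict (mapsTo_range_g S ψ)) *
        LinearMap.det (ψ.τ₂.hom.restrict (mapsTo_range_f S ψ)) := by
  have h1 : LinearMap.det ((LinearMap.ker S.g.hom).mapQ (LinearMap.ker S.g.hom) ψ.τ₂.hom (mapsTo_ker_g S ψ)) =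
      LinearMap.det (ψ.τ₃.hom.restrict (mapsTo_range_g S ψ)) := by
    rw [← conj_mapQ_ker_g_eq S ψ, det_linearEquiv_conj]
  have h2 : LinearMap.det ((ψ.τ₂.hom.restrict (mapsTo_ker_g S ψ)).restrict (mapsTo_range_moduleCatToCycles S ψ)) =
      LinearMap.det (ψ.τ₂.hom.restrict (mapsTo_range_f S ψ)) := by
    rw [← conj_restrict_range_toCycles_eq S ψ, det_linearEquiv_conj]
  have h3 : LinearMap.det ((LinearMap.range S.moduleCatToCycles).mapQ (LinearMap.range S.moduleCatToCycles)
      (ψ.τ₂.hom.restrict (mapsTo_ker_g S ψ)) (fun x hx => mapsTo_range_moduleCatToCycles S ψ x hx)) =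
      LinearMap.det (ShortComplex.homologyMap ψ).hom := by
    let e : S.homology ≃ₗ[K] (LinearMap.ker S.g.hom ⧸ LinearMap.range S.moduleCatToCycles) := S.moduleCatHomologyIso.toLinearEquiv
    have he : e.conj (ShortComplex.homologyMap ψ).hom = (LinearMap.range S.moduleCatToCycles).mapQ (LinearMap.range S.moduleCatToCycles)
        (ψ.τ₂.hom.restrict (mapsTo_ker_g S ψ)) (fun x hx => mapsTo_range_moduleCatToCycles S ψ x hx) := by
      refine LinearMap.ext fun q => ?_
      obtain ⟨h, rfl⟩ := e.surjective q
      rw [LinearEquiv.conj_apply_apply, LinearEquiv.symm_apply_apply]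
      have hsq := congrArg (fun χ => χ.hom h) (homologyMap_comp_moduleCatHomologyIso_hom S ψ)
      simp only [ModuleCat.hom_comp, LinearMap.comp_apply] at hsq
      exact hsq
    rw [← he, det_linearEquiv_conj]
  rw [LinearMap.det_eq_det_mul_det (LinearMap.ker S.g.hom) ψ.τ₂.hom (fun x hx => mapsTo_ker_g S ψ x hx),
    LinearMap.det_eq_det_mul_det (LinearMap.range S.moduleCatToCycles) (ψ.τ₂.hom.restrict (mapsTo_ker_g S ψ))
      (fun x hx => mapsTo_range_moduleCatToCycles S ψ x hx), h1, h2, h3]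
  ring

end ShortComplex

/-- An endomorphism with non-zero determinant restricts, on an invariant subspace, to one with non-zero determinant (injectivity is
inherited). [cite: Lang2002, Ch. XX §3] -/
theorem det_restrict_ne_zero {M : Type*} [AddCommGroup M] [Module K M] [Module.Finite K M] (f : M →ₗ[K] M) (hf : LinearMap.det f ≠ 0)
    {p : Submodule K M} (hp : ∀ x ∈ p, f x ∈ p) : LinearMap.det (f.restrict hp) ≠ 0 := by
  intro h0
  have hk : LinearMap.ker f = ⊥ := not_ne_iff.1 fun h => hf (LinearMap.det_eq_zero_iff_ker_ne_bot.2 h)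
  refine LinearMap.det_eq_zero_iff_ker_ne_bot.1 h0 ((Submodule.eq_bot_iff _).2 fun x hx => Subtype.ext ?_)
  have hx' : f x = 0 := congrArg Subtype.val (LinearMap.mem_ker.1 hx)
  exact (LinearMap.ker_eq_bot'.1 hk) _ hx'

variable {ι : Type w} {c : ComplexShape ι} (C : HomologicalComplex (ModuleCat.{v} K) c) (φ : C ⟶ C)

/-! ### A complex -/

/-- **Degreewise**: `det φᵢ = det H(φ)ᵢ · det(φ_{next i} | im d(i, next i)) · det(φᵢ | im d(prev i, i))` (`Cⁱ` finite-dimensional; `det_τ₂_eq` on `C.sc i`).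
[cite: Lang2002, Ch. XX §3] -/
theorem det_f_eq (i : ι) [Module.Finite K (C.X i)] :
    LinearMap.det (φ.f i).hom =
      LinearMap.det (HomologicalComplex.homologyMap φ i).hom *
        LinearMap.det ((φ.f (c.next i)).hom.restrict (mapsTo_range_d C φ i (c.next i))) *
        LinearMap.det ((φ.f i).hom.restrict (mapsTo_range_d C φ (c.prev i) i)) :=
  haveI : Module.Finite K (C.sc i).X₂ := inferInstanceAs (Module.Finite K (C.X i))
  det_τ₂_eq (C.sc i) ((HomologicalComplex.shortComplexFunctor _ c i).map φ)

/-- **The determinant Euler–Poincaré identity**: if every `det φᵢ ≠ 0`, then `∏ᶠ i, det(φᵢ)^{χ(i)} = ∏ᶠ i, det(H(φ)ᵢ)^{χ(i)}` in `K`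
(`ℤ`-powers; finitely many non-zero terms) — row `EulerPoincarePrinciple` in `Kˣ`, fed by `det_f_eq`. [cite: Lang2002, Ch. XX §3, Thm. 3.1] -/
theorem finprod_det_zpow_χ_eq [c.EulerCharSigns] [∀ i, Module.Finite K (C.X i)] (hC : (GradedObject.finrankSupport C.X).Finite)
    (hφ : ∀ i, LinearMap.det (φ.f i).hom ≠ 0) :
    ∏ᶠ i, LinearMap.det (φ.f i).hom ^ ((c.χ i : ℤ)) = ∏ᶠ i, LinearMap.det (HomologicalComplex.homologyMap φ i).hom ^ ((c.χ i : ℤ)) := by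
  classical
  -- every factor of `det_f_eq` is non-zero
  have hB : ∀ i j, LinearMap.det ((φ.f j).hom.restrict (mapsTo_range_d C φ i j)) ≠ 0 := fun i j =>
    det_restrict_ne_zero _ (hφ j) _
  have hH : ∀ i, LinearMap.det (HomologicalComplex.homologyMap φ i).hom ≠ 0 := fun i h0 =>
    hφ i (by rw [det_f_eq C φ i, h0, zero_mul, zero_mul])
  have h1 : ∀ {M : Type v} [AddCommGroup M] [Module K M] (f : M →ₗ[K] M) (hf : LinearMap.det f ≠ 0), Subsingleton M →
      Units.mk0 _ hf = 1 := fun f hf _ => Units.ext (by rw [Units.val_mk0, Units.val_one, Subsingleton.elim f LinearMap.id, LinearMap.det_id])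
  have hz : ∀ i, Module.finrank K (C.X i) = 0 → Subsingleton (C.X i) := fun i h0 => Module.finrank_zero_iff.1 h0
  have hsupp : ∀ (g : ι → Kˣ), (∀ i, Subsingleton (C.X i) → g i = 1) → g.HasFiniteMulSupport := fun g hg =>
    hC.subset fun i hi => by
      simp only [GradedObject.finrankSupport, Function.mem_support, ne_eq]
      exact fun h0 => hi (hg i (hz i h0))
  -- the units, and the abstract Euler–Poincaré principle in `Kˣ`
  have total := finprod_zpow_χ_eq_of_degreewise (c := c) (fun i => Units.mk0 _ (hφ i)) (fun i => Units.mk0 _ (hH i))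
    (fun i => Units.mk0 _ (hB i (c.next i))) (fun j => Units.mk0 _ (hB (c.prev j) j))
    (fun i => Units.ext (by simp only [Units.val_mul, Units.val_mk0, det_f_eq C φ i, mul_assoc]))
    (fun j hj => h1 _ _ (by rw [C.shape _ _ hj, ModuleCat.hom_zero, LinearMap.range_zero]; infer_instance))
    (fun i hi => h1 _ _ (by rw [C.shape _ _ hi, ModuleCat.hom_zero, LinearMap.range_zero]; infer_instance))
    (fun i j hij => by
      have h1 : c.prev j = i := c.prev_eq' hij
      have h2 : c.next i = j := c.next_eq' hij
      subst h1
      apply Units.ext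
      simp only [Units.val_mk0]
      rw [h2])
    (hsupp _ fun i hi => by haveI := subsingleton_homology_of_subsingleton C i; exact h1 _ _ ‹_›)
    (hsupp _ fun i hi => h1 _ _ (by rw [Subsingleton.elim (C.d i (c.next i)).hom 0, LinearMap.range_zero]; infer_instance))
    (hsupp _ fun i hi => h1 _ _ inferInstance)
  -- read the units identity in `K`
  have key : ∀ (u : ι → Kˣ), u.HasFiniteMulSupport → (((∏ᶠ i, u i ^ ((c.χ i : ℤ)) : Kˣ)) : K) = ∏ᶠ i, (u i : K) ^ ((c.χ i : ℤ)) :=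
    fun u hu => by
    have hu' : (fun i => u i ^ ((c.χ i : ℤ))).HasFiniteMulSupport := hu.subset fun i hi => by
      simp only [Function.mem_mulSupport, ne_eq] at hi ⊢
      exact fun h => hi (by rw [h, one_zpow])
    rw [← Units.coeHom_apply, MonoidHom.map_finprod _ hu']
    exact finprod_congr fun i => by rw [map_zpow, Units.coeHom_apply]
  have h := congrArg (fun x : Kˣ => (x : K)) total
  have sF : (fun i => Units.mk0 _ (hφ i)).HasFiniteMulSupport := hsupp _ fun i hi => h1 _ _ hi
  have sH : (fun i => Units.mk0 _ (hH i)).HasFiniteMulSupport :=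
    hsupp _ fun i hi => by haveI := subsingleton_homology_of_subsingleton C i; exact h1 _ _ ‹_›
  simpa only [key _ sF, key _ sH, Units.val_mk0] using h

end Literature.Algebra.Homology.HopfTrace
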